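/-
Copyright (c) 2026 the pub-hodgecm-mathlib formalisation cell (harness21).  Prover seat hodgecm-mathlib-K2E1-p08 (g4), Track B ∕ K2-LIT, h413 =
`stmt-HodgeConjecture-24833`, line `K2_E1_TraceFormulaBeta`, campaign «RES-RANK-ONE»; DEAL «(H4-a) ELIMINATION» of the dealer K2E1-plan (g2) 2026-09-04T03:26:16Z, FILE II:
the sockets 5Res ∕ 12R3 from (H4-b) EXPONENT FINITENESS ALONE — the regularity input (H4-a) of ★ p857039 is discharged by smoothing with `K`-central test functions (FILE I).
-/
import Summits.HodgeConjecture.HodgeConjecture.Theorems.K2E1ResidualAdmissibleOfExponents   -- ★ p857039 (this seat): `finiteDimensional_of_reg_exp`, lattice data, `finite_index`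
import Summits.HodgeConjecture.HodgeConjecture.Theorems.K2E1CentralTestFunctions               -- ★ (this seat, FILE I): `comp_integratedOperator_of_central`, `exists_central_norm_integratedOperator_apply_sub_le`
import HarnessLib

/-!
# K2·E1 — `K2E1ResidualAdmissibleOfExponentsSmooth`: (FD) AND THE SOCKETS 5Res ∕ 12R3 FROM (H4-b) EXPONENT FINITENESS ALONE
# (campaign «RES-RANK-ONE», (H4-a) elimination, file II: the assembly)

Track B ∕ K2-LIT, crux h413 = `stmt-HodgeConjecture-24833`, route of record `HCCMUnconditional`; cell `hodgecm-mathlib`, squad K2, ENGINE E1 (socket module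
`K2_E1_TraceFormulaBetaSigs_GlobalIndex` ED. 12; live sockets 5Res :247 = ★ `CmResidualSpectrumCompact L 2 μ`, 12R3 :293 = ★ `CmResidualSpectrumCompactR L 3 μ`).  Prover seat
`hodgecm-mathlib-K2E1-p08` (g4); DEAL «(H4-a) ELIMINATION» of the dealer K2E1-plan (g2) 2026-09-04T03:26:16Z.  THEOREMS ONLY (no `def`, no `instance`, no notation, no named-fact
hypothesis, no `sorry`); lane `--supports stmt-HodgeConjecture-24833 --as helper` (count-neutral).  CLOSES NO SOCKET: it makes 5Res ∕ 12R3 read «⟸ (H4-b)», ONE print-named input.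

THE INPUT (hypothesis, `def`-free; `V = homRangeSum ρ_K(E)` the `E`-isotypic part of `L²_res|_K` for an irreducible finite-dimensional `K`-type `E`, one fixed Haar measure `ν_N i` and one
fundamental domain `𝓕 i` of `N_i(K)` per radical):
* (H4-b) EXPONENT FINITENESS `hexp : ∃ T ≤ (G(𝔸) → ℂ), FiniteDimensional ℂ T ∧ ∀ w ∈ V, ∀ ψ (continuous square-integrable representative of w), ∀ i, (x ↦ ∫_{𝓕 i} ψ((xu⁻¹)Q) dν_N i) ∈ T` —
  the constant terms of the `K`-type-`E` residual forms lie in ONE finite-dimensional space [MoeglinWaldspurger1995, IV.1.11, V.3.13; Langlands1976, §7].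
The former second input (H4-a) «every `w ∈ V` HAS a continuous representative» [HarishChandra1968 α-lemma] is NOT needed: `hexp` only ever speaks about vectors that have one.

WHAT.
* §1 GENERIC **`finiteDimensional_homRangeSum_of_exp`** (any ★ `AdelicGroupData` 𝒢 with `G(𝔸)` second countable locally compact Hausdorff, automorphic `μ`, radicals `𝔓` with the lattice
  data of ★ p857039, compact `K` with continuous `ιK : K →* G(𝔸)`, `E ≤ L²_res` finite-dimensional irreducible `K`-stable — the `hadm` binders of ★ p856793): (H4-b) ⟹ `FiniteDimensional ℂ V`.
  Proof.  Let `S := span {R|_{L²_res}(f) v : v ∈ V, f ∈ C_c(G(𝔸)) K-central}`.  (a) `S ≤ V`: for `K`-central `f`, `R(f)` commutes with `R(ιK)` (★ FILE I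
  `comp_integratedOperator_of_central`), hence preserves the isotypic part (★ `Representation.map_homRangeSum_le_of_commute`).  (b) `S` satisfies (H4-a): `R(f)v` has the
  continuous representative `S_f v` (★ `toLp_orbitalSmoothing_eq`, `continuous_orbitalSmoothing_L2`), and representatives add.  (c) `S` satisfies (H4-b) by restriction.  Hence
  `S` is FINITE-DIMENSIONAL (★ p857039 `finiteDimensional_of_reg_exp`), so CLOSED (Mathlib `Submodule.closed_of_finiteDimensional`); and DENSE in `V`: `‖R(f)v − v‖ ≤ ε` for a
  `K`-central `f` (★ FILE I `exists_central_norm_integratedOperator_apply_sub_le`).  So `V ≤ S` is finite-dimensional.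
* §2 **`cmResidualSpectrumCompact_two_of_exp : CmResidualSpectrumCompact L 2 μ`** (5Res's matrix) ∕ **`cmResidualSpectrumCompactR_three_of_exp : CmResidualSpectrumCompactR L 3 μ`**
  (12R3's) from `hexp` per `K`-type ALONE (★ p856793 `residualSpectrumCompact_of_admissible`; lattice data ★ as in p857039).  BY-NAME wrappers (Sigs :247 ∕ :293 verbatim from the
  `∀ L μ ∃(K, ιK, ν_N, 𝓕)`-package of `hexp`) are the companion `K2E1ResidualAdmissibleOfExponentsSmoothSigs`.
HONEST LABEL: HC_CM is proved only modulo the 7 printed citations (2 remaining named inputs: hLiu418 = `stmt-HodgeConjecture-24832`, h413 = `stmt-HodgeConjecture-24833`) until rung 0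
closes; this file asserts no named fact and closes no socket — 5Res ∕ 12R3 now read «⟸ (H4-b) exponent finiteness», the finiteness clause of rank-one Borel Eisenstein theory for
`U(Φ₂)` ∕ `U(Φ₃)` (junction K2Liu at `m = 1`), the campaign's single named input.
References: [MoeglinWaldspurger1995] I.2.18, IV.1.11, V.3.13 · [Langlands1976] §7 · [HarishChandra1968] Thm. 1, Lemma «φ = φ∗α» · [BorelJacquet1979] §4.3–4.6 · [DeitmarEchterhoff2014]
Lemma 6.2.2, Lemma 9.2.7 · [Rogawski1990] §13.5 pp. 204–206, §13.9 p. 227.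
-/

set_option autoImplicit false
-- the mandated namespace repeats the single-problem summit's segment (`HodgeConjecture.HodgeConjecture`)
set_option linter.dupNamespace false

noncomputable section

open MeasureTheory Measure Filter Topology Set NumberField IsDedekindDomain CompactlySupported
open scoped ENNReal NNReal Pointwise
open Literature.NumberTheory.Automorphic Literature.NumberTheory.Automorphic.UnitaryGroup AdelicGroupData
open Summit.HodgeConjecture.HodgeConjecture.Cruxes.H413.K2E1CuspidalSpectrumUnitary
open Summit.HodgeConjecture.HodgeConjecture.Cruxes.H413.K2E1SiegelRadicalCocompactU2 (countable_rational_cmParabolicData exists_isCompact_rational_smul_mem_siegel)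
open Summit.HodgeConjecture.HodgeConjecture.Cruxes.H413.K2E1HeisenbergRadicalCocompactU3
  (countable_rational_cmParabolicDataR_three exists_isCompact_rational_smul_mem_heisenberg)
open Summit.HodgeConjecture.HodgeConjecture.Cruxes.H413.K2E1ResidualConstantTermFunctional (memLp_orbitalSmoothing toLp_orbitalSmoothing_eq)
open Summit.HodgeConjecture.HodgeConjecture.Cruxes.H413.K2E1SmoothedFormRepresentative (continuous_orbitalSmoothing_L2)
open Summit.HodgeConjecture.HodgeConjecture.Cruxes.H413.K2E1ResidualCompactOfAdmissible (residualSpectrumCompact_of_admissible)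
open Summit.HodgeConjecture.HodgeConjecture.Cruxes.H413.K2E1BorelLeviU (isClosed_cmParabolicData_radical_two isClosed_cmParabolicDataR_radical_three)
open Summit.HodgeConjecture.HodgeConjecture.Cruxes.H413.K2E1ResidualAdmissibleOfExponents (finiteDimensional_of_reg_exp finite_index)
open Summit.HodgeConjecture.HodgeConjecture.Cruxes.H413.K2E1CentralTestFunctions

namespace Summit.HodgeConjecture.HodgeConjecture.Cruxes.H413.K2E1ResidualAdmissibleOfExponentsSmooth

/-! ## §1 Generic: (H4-b) alone gives (FD) -/

section Generic

variable {F : Type} [Field F] [NumberField F] (𝒢 : AdelicGroupData.{0} F) [LocallyCompactSpace 𝒢.Adelic] [SecondCountableTopology 𝒢.Adelic] [T2Space 𝒢.Adelic]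
  (μ : Measure 𝒢.automorphicQuotient) [𝒢.IsAutomorphicMeasure μ] (𝔓 : 𝒢.ParabolicUnipotentData)

omit [LocallyCompactSpace 𝒢.Adelic] [SecondCountableTopology 𝒢.Adelic] [T2Space 𝒢.Adelic] in
/-- The `L²`-value of the restricted operator: `R(f) (w : L²) = (R|_W(f) w : L²)` for a closed invariant `W` (Bochner integrals commute with the inclusion; verbatim the computation
inside ★ p856793 `residualSpectrumCompact_of_admissible`). [cite: DeitmarEchterhoff2014, Lemma 9.2.7] -/
theorem integratedOperator_coe_eq_coe_toContRep [MeasurableSpace 𝒢.Adelic] [BorelSpace 𝒢.Adelic] (W : ContRepresentation.ClosedSubrep (𝒢.rightRegular μ))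
    (hWu : W.toContRep.IsUnitary) (hWc : W.toContRep.IsStronglyContinuous) (ν : Measure 𝒢.Adelic) [IsFiniteMeasureOnCompacts ν] (f : C_c(𝒢.Adelic, ℂ)) (w : W.toSubmodule) :
    (𝒢.rightRegular μ).integratedOperator (𝒢.isUnitary_rightRegular μ) (𝒢.isStronglyContinuous_rightRegular_holds μ) ν f (w : 𝒢.L2 μ) =
      ((W.toContRep.integratedOperator hWu hWc ν f w : W.toSubmodule) : 𝒢.L2 μ) := by
  change _ = W.toSubmodule.subtypeL (W.toContRep.integratedOperator hWu hWc ν f w)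
  rw [ContRepresentation.integratedOperator_apply, ContRepresentation.integratedOperator_apply]
  refine Eq.trans ?_ ((W.toSubmodule.subtypeL).integral_comp_comm (ContRepresentation.integrable_smul_apply hWc ν f w))
  exact integral_congr_ae (Eventually.of_forall fun g => rfl)

/-- **(FD) FROM (H4-b) ALONE.**  `𝒢` an adelic group datum (`G(𝔸)` second countable locally compact Hausdorff), `μ` automorphic, `𝔓` radicals with finitely many indices, each `N_i(K)` countable
with a compact fundamental set in the locally compact second countable `N_i(𝔸)`; one Haar measure `ν_N i` and one fundamental domain `𝓕 i` per index; `K` compact with continuous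
`ιK : K →* G(𝔸)`; `E ≤ L²_res` a `K`-stable subspace and `V` its isotypic part `homRangeSum`.  IF (H4-b) the constant terms of the continuous square-integrable representatives of vectors of
`V` lie in one finite-dimensional space `T`, THEN `V` is finite-dimensional — the `hadm` binder of ★ p856793.  (★ p857039 `finiteDimensional_of_reg_exp` applied to the span `S ≤ V` of the
smoothings `R(f)v`, `f` `K`-central — which HAVE continuous representatives —, `S` is closed and dense in `V`.) [cite: MoeglinWaldspurger1995, I.2.18 and V.3.13] [cite: HarishChandra1968, Thm. 1] [cite: Langlands1976, §7] -/
theorem finiteDimensional_homRangeSum_of_exp [Finite 𝔓.ι] [∀ i, MeasurableSpace (𝔓.radical i)] [∀ i, BorelSpace (𝔓.radical i)]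
    [∀ i, LocallyCompactSpace (𝔓.radical i)] [∀ i, SecondCountableTopology (𝔓.radical i)] [∀ i, Countable (𝔓.rational i)]
    (C : ∀ i, Set (𝔓.radical i)) (hC : ∀ i, IsCompact (C i)) (hcov : ∀ i (u : 𝔓.radical i), ∃ l : 𝔓.rational i, l • u ∈ C i)
    (νN : ∀ i, Measure (𝔓.radical i)) [∀ i, (νN i).IsHaarMeasure] (𝓕 : ∀ i, Set (𝔓.radical i))
    (h𝓕 : ∀ i, IsFundamentalDomain (𝔓.rational i) (𝓕 i) (νN i))
    {K : Type*} [Group K] [TopologicalSpace K] [IsTopologicalGroup K] [CompactSpace K] (ιK : K →* 𝒢.Adelic) (hι : Continuous ιK)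
    (E : Submodule ℂ (residualSubspace 𝒢 μ 𝔓).toSubmodule) (hE : ∀ k, ∀ x ∈ E, ((residualSubspace 𝒢 μ 𝔓).toContRep.restrict ιK) k x ∈ E)
    (hexp : ∃ T : Submodule ℂ (𝒢.Adelic → ℂ), FiniteDimensional ℂ T ∧
      ∀ w ∈ Representation.homRangeSum ((residualSubspace 𝒢 μ 𝔓).toContRep.restrict ιK).toRepresentation
          (((residualSubspace 𝒢 μ 𝔓).toContRep.restrict ιK).subRep E hE),
        ∀ ψ : 𝒢.automorphicQuotient → ℂ, Continuous ψ → ∀ hψ : MemLp ψ 2 μ,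
          hψ.toLp ψ = ((w : (residualSubspace 𝒢 μ 𝔓).toSubmodule) : 𝒢.L2 μ) →
            ∀ i : 𝔓.ι, (fun x : 𝒢.Adelic => ∫ u in 𝓕 i, ψ (𝒢.toAutomorphicQuotient (x * (u : 𝒢.Adelic)⁻¹)) ∂(νN i)) ∈ T) :
    FiniteDimensional ℂ (Representation.homRangeSum ((residualSubspace 𝒢 μ 𝔓).toContRep.restrict ιK).toRepresentation
      (((residualSubspace 𝒢 μ 𝔓).toContRep.restrict ιK).subRep E hE)) := by
  classical
  letI : MeasurableSpace 𝒢.Adelic := borel _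
  haveI : BorelSpace 𝒢.Adelic := ⟨rfl⟩
  have hWu : (residualSubspace 𝒢 μ 𝔓).toContRep.IsUnitary := (𝒢.isUnitary_rightRegular μ).toContRep _
  have hWc : (residualSubspace 𝒢 μ 𝔓).toContRep.IsStronglyContinuous :=
    isStronglyContinuous_toContRep_of_isStronglyContinuous (𝒢.isStronglyContinuous_rightRegular_holds μ) _
  let ν : Measure 𝒢.Adelic := Measure.haar
  let ρ : Representation ℂ K (residualSubspace 𝒢 μ 𝔓).toSubmodule := ((residualSubspace 𝒢 μ 𝔓).toContRep.restrict ιK).toRepresentation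
  let V : Submodule ℂ (residualSubspace 𝒢 μ 𝔓).toSubmodule := Representation.homRangeSum ρ (((residualSubspace 𝒢 μ 𝔓).toContRep.restrict ιK).subRep E hE)
  -- the span of the `K`-central smoothings of vectors of `V`
  let gens : Set (residualSubspace 𝒢 μ 𝔓).toSubmodule := {w | ∃ (f : C_c(𝒢.Adelic, ℂ)) (v : (residualSubspace 𝒢 μ 𝔓).toSubmodule),
    (∀ k g, f (ιK k * g * (ιK k)⁻¹) = f g) ∧ v ∈ V ∧ w = (residualSubspace 𝒢 μ 𝔓).toContRep.integratedOperator hWu hWc ν f v}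
  let S : Submodule ℂ (residualSubspace 𝒢 μ 𝔓).toSubmodule := Submodule.span ℂ gens
  -- (a) `S ≤ V`: `R(f)` for `K`-central `f` commutes with `ρ(K)` and so preserves the isotypic part
  have hgenV : ∀ (f : C_c(𝒢.Adelic, ℂ)) (v : (residualSubspace 𝒢 μ 𝔓).toSubmodule), (∀ k g, f (ιK k * g * (ιK k)⁻¹) = f g) → v ∈ V →
      (residualSubspace 𝒢 μ 𝔓).toContRep.integratedOperator hWu hWc ν f v ∈ V := by
    intro f v hf hv
    have hcomm : ∀ k, ((residualSubspace 𝒢 μ 𝔓).toContRep.integratedOperator hWu hWc ν f).toLinearMap ∘ₗ ρ k =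
        ρ k ∘ₗ ((residualSubspace 𝒢 μ 𝔓).toContRep.integratedOperator hWu hWc ν f).toLinearMap := by
      intro k
      have hx := fun x => congrArg (fun T : (residualSubspace 𝒢 μ 𝔓).toSubmodule →L[ℂ] (residualSubspace 𝒢 μ 𝔓).toSubmodule => T x)
        (comp_integratedOperator_of_central ν hWu hWc hι f hf k)
      exact LinearMap.ext fun x => (hx x).symm
    exact Representation.map_homRangeSum_le_of_commute _ hcomm (Submodule.mem_map_of_mem hv)
  have hSV : S ≤ V := Submodule.span_le.2 (by rintro w ⟨f, v, hf, hv, rfl⟩; exact hgenV f v hf hv)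
  -- (b) continuous representatives on `S`
  have hregS : ∀ w ∈ S, ∃ ψ : 𝒢.automorphicQuotient → ℂ, Continuous ψ ∧ ∃ hψ : MemLp ψ 2 μ,
      hψ.toLp ψ = ((w : (residualSubspace 𝒢 μ 𝔓).toSubmodule) : 𝒢.L2 μ) := by
    intro w hw
    induction hw using Submodule.span_induction with
    | mem w h =>
      obtain ⟨f, v, -, -, rfl⟩ := h
      refine ⟨orbitalSmoothing ν (f : 𝒢.Adelic → ℂ) ((v : 𝒢.L2 μ) : 𝒢.automorphicQuotient → ℂ), continuous_orbitalSmoothing_L2 𝒢 μ ν f (v : 𝒢.L2 μ),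
        memLp_orbitalSmoothing 𝒢 μ ν f (v : 𝒢.L2 μ), ?_⟩
      rw [toLp_orbitalSmoothing_eq 𝒢 μ ν f (v : 𝒢.L2 μ)]
      exact integratedOperator_coe_eq_coe_toContRep 𝒢 μ _ hWu hWc ν f v
    | zero => exact ⟨0, continuous_zero, MemLp.zero, by rw [MemLp.toLp_zero]; rfl⟩
    | add w₁ w₂ _ _ h₁ h₂ =>
      obtain ⟨ψ₁, hc₁, hm₁, he₁⟩ := h₁
      obtain ⟨ψ₂, hc₂, hm₂, he₂⟩ := h₂
      refine ⟨ψ₁ + ψ₂, hc₁.add hc₂, hm₁.add hm₂, ?_⟩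
      rw [MemLp.toLp_add hm₁ hm₂, he₁, he₂]
      rfl
    | smul a w _ h =>
      obtain ⟨ψ, hc, hm, he⟩ := h
      refine ⟨a • ψ, hc.const_smul a, hm.const_smul a, ?_⟩
      rw [MemLp.toLp_const_smul a hm, he]
      rfl
  -- (c) exponent finiteness on `S`, by restriction
  have hexpS : ∃ T : Submodule ℂ (𝒢.Adelic → ℂ), FiniteDimensional ℂ T ∧
      ∀ w ∈ S, ∀ ψ : 𝒢.automorphicQuotient → ℂ, Continuous ψ → ∀ hψ : MemLp ψ 2 μ,
        hψ.toLp ψ = ((w : (residualSubspace 𝒢 μ 𝔓).toSubmodule) : 𝒢.L2 μ) →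
          ∀ i : 𝔓.ι, (fun x : 𝒢.Adelic => ∫ u in 𝓕 i, ψ (𝒢.toAutomorphicQuotient (x * (u : 𝒢.Adelic)⁻¹)) ∂(νN i)) ∈ T := by
    obtain ⟨T, hT, h⟩ := hexp
    exact ⟨T, hT, fun w hw => h w (hSV hw)⟩
  -- hence `S` is finite-dimensional and closed
  haveI hSfd : FiniteDimensional ℂ S := finiteDimensional_of_reg_exp 𝒢 μ 𝔓 C hC hcov νN 𝓕 h𝓕 S hregS hexpS
  have hSc : IsClosed (S : Set (residualSubspace 𝒢 μ 𝔓).toSubmodule) := S.closed_of_finiteDimensional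
  -- (d) `V ≤ closure S = S`
  have hVS : V ≤ S := by
    intro v hv
    have hmem : v ∈ closure (S : Set (residualSubspace 𝒢 μ 𝔓).toSubmodule) := by
      refine Metric.mem_closure_iff.2 fun ε hε => ?_
      obtain ⟨f, hf, hle⟩ := exists_central_norm_integratedOperator_apply_sub_le ν hWu hWc hι v (half_pos hε)
      refine ⟨(residualSubspace 𝒢 μ 𝔓).toContRep.integratedOperator hWu hWc ν f v, Submodule.subset_span ⟨f, v, hf, hv, rfl⟩, ?_⟩
      rw [dist_eq_norm, ← norm_neg, neg_sub]
      exact hle.trans_lt (half_lt_self hε)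
    rwa [hSc.closure_eq] at hmem
  exact Submodule.finiteDimensional_of_le hVS

end Generic

/-! ## §2 The sockets 5Res (`U(Φ₂)`) and 12R3 (`U(Φ₃)`) from (H4-b) alone -/

section Unitary

variable (L : Type) [Field L] [NumberField L] [IsCMField L]

/-- **SOCKET 5Res `sig_K2E1ResidualCompactU2` ⟸ (H4-b) ALONE.**  For `U(Φ₂)` over the CM field `L`, an automorphic `μ`, a Borel structure on the Siegel radical, a compact Hausdorff `K` with continuous
`ιK : K →* U(Φ₂)(𝔸_{L⁺})`, one Haar measure and one fundamental domain of `N(L⁺)` on the radical: if for every irreducible finite-dimensional `K`-type `E` of `L²_res|_K` the constant terms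
of the continuous representatives of the `E`-isotypic residual vectors lie in ONE finite-dimensional space, then ★ `CmResidualSpectrumCompact L 2 μ`.
[cite: MoeglinWaldspurger1995, I.2.18 and V.3.13] [cite: Langlands1976, §7] [cite: Rogawski1990, §13.5 pp. 204–206] -/
theorem cmResidualSpectrumCompact_two_of_exp
    (μ : Measure (cmDatum L 2 (Matrix.of fun i j : Fin 2 => if i.val + j.val + 1 = 2 then (1 : L) else 0)).automorphicQuotient)
    [(cmDatum L 2 (Matrix.of fun i j : Fin 2 => if i.val + j.val + 1 = 2 then (1 : L) else 0)).IsAutomorphicMeasure μ]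
    [∀ i, MeasurableSpace ((cmParabolicData L 2).radical i)] [∀ i, BorelSpace ((cmParabolicData L 2).radical i)]
    {K : Type*} [Group K] [TopologicalSpace K] [IsTopologicalGroup K] [CompactSpace K] [T2Space K]
    (ιK : K →* (cmDatum L 2 (Matrix.of fun i j : Fin 2 => if i.val + j.val + 1 = 2 then (1 : L) else 0)).Adelic) (hι : Continuous ιK)
    (νN : ∀ i, Measure ((cmParabolicData L 2).radical i)) [∀ i, (νN i).IsHaarMeasure] (𝓕 : ∀ i, Set ((cmParabolicData L 2).radical i))
    (h𝓕 : ∀ i, IsFundamentalDomain ((cmParabolicData L 2).rational i) (𝓕 i) (νN i))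
    (hexp : ∀ (E : Submodule ℂ (cmResidualSubspace L 2 μ).toSubmodule) (hE : ∀ k, ∀ x ∈ E, ((cmResidualSubspace L 2 μ).toContRep.restrict ιK) k x ∈ E),
      FiniteDimensional ℂ E → (((cmResidualSubspace L 2 μ).toContRep.restrict ιK).subRep E hE).IsIrreducible →
      ∃ T : Submodule ℂ ((cmDatum L 2 (Matrix.of fun i j : Fin 2 => if i.val + j.val + 1 = 2 then (1 : L) else 0)).Adelic → ℂ), FiniteDimensional ℂ T ∧
        ∀ w ∈ Representation.homRangeSum ((cmResidualSubspace L 2 μ).toContRep.restrict ιK).toRepresentation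
            (((cmResidualSubspace L 2 μ).toContRep.restrict ιK).subRep E hE),
          ∀ ψ : (cmDatum L 2 (Matrix.of fun i j : Fin 2 => if i.val + j.val + 1 = 2 then (1 : L) else 0)).automorphicQuotient → ℂ, Continuous ψ → ∀ hψ : MemLp ψ 2 μ,
            hψ.toLp ψ = ((w : (cmResidualSubspace L 2 μ).toSubmodule) : (cmDatum L 2 (Matrix.of fun i j : Fin 2 => if i.val + j.val + 1 = 2 then (1 : L) else 0)).L2 μ) →
              ∀ i, (fun x => ∫ u in 𝓕 i, ψ ((cmDatum L 2 (Matrix.of fun i j : Fin 2 => if i.val + j.val + 1 = 2 then (1 : L) else 0)).toAutomorphicQuotient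
                (x * (u : (cmDatum L 2 (Matrix.of fun i j : Fin 2 => if i.val + j.val + 1 = 2 then (1 : L) else 0)).Adelic)⁻¹)) ∂(νN i)) ∈ T) :
    CmResidualSpectrumCompact L 2 μ :=
  residualSpectrumCompact_of_admissible _ μ (cmParabolicData L 2) ιK hι fun E hE hfd hirr => by
    haveI : ∀ i, Countable ((cmParabolicData L 2).rational i) := fun i => countable_rational_cmParabolicData L i
    haveI : ∀ i, LocallyCompactSpace ((cmParabolicData L 2).radical i) := fun i => (isClosed_cmParabolicData_radical_two L i).locallyCompactSpace
    haveI : ∀ i, SecondCountableTopology ((cmParabolicData L 2).radical i) := fun i => TopologicalSpace.Subtype.secondCountableTopology _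
    haveI : Finite (cmParabolicData L 2).ι := finite_index 2
    have hcpt : ∀ i : (cmParabolicData L 2).ι, ∃ C : Set ((cmParabolicData L 2).radical i), IsCompact C ∧
        ∀ u : (cmParabolicData L 2).radical i, ∃ l : (cmParabolicData L 2).rational i, l • u ∈ C := by
      intro i
      obtain ⟨k, hk⟩ := i
      obtain rfl : k = 1 := by omega
      exact exists_isCompact_rational_smul_mem_siegel L (antidiagOne_eq_over (L := L) (N := 2)).symm
    choose C hC hcov using hcpt
    exact finiteDimensional_homRangeSum_of_exp _ μ (cmParabolicData L 2) C hC hcov νN 𝓕 h𝓕 ιK hι E hE (hexp E hE hfd hirr)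

/-- **SOCKET 12R3 `sig_K2E1ResidualCompactU3R` ⟸ (H4-b) ALONE** — the same for `U(Φ₃)` along the Heisenberg radical of record (★ `cmParabolicDataR L 3`).
[cite: MoeglinWaldspurger1995, I.2.18 and V.3.13] [cite: Langlands1976, §7] [cite: Rogawski1990, §13.9 p. 227] -/
theorem cmResidualSpectrumCompactR_three_of_exp
    (μ : Measure (cmDatum L 3 (Matrix.of fun i j : Fin 3 => if i.val + j.val + 1 = 3 then (1 : L) else 0)).automorphicQuotient)
    [(cmDatum L 3 (Matrix.of fun i j : Fin 3 => if i.val + j.val + 1 = 3 then (1 : L) else 0)).IsAutomorphicMeasure μ]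
    [∀ i, MeasurableSpace ((cmParabolicDataR L 3).radical i)] [∀ i, BorelSpace ((cmParabolicDataR L 3).radical i)]
    {K : Type*} [Group K] [TopologicalSpace K] [IsTopologicalGroup K] [CompactSpace K] [T2Space K]
    (ιK : K →* (cmDatum L 3 (Matrix.of fun i j : Fin 3 => if i.val + j.val + 1 = 3 then (1 : L) else 0)).Adelic) (hι : Continuous ιK)
    (νN : ∀ i, Measure ((cmParabolicDataR L 3).radical i)) [∀ i, (νN i).IsHaarMeasure] (𝓕 : ∀ i, Set ((cmParabolicDataR L 3).radical i))
    (h𝓕 : ∀ i, IsFundamentalDomain ((cmParabolicDataR L 3).rational i) (𝓕 i) (νN i))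
    (hexp : ∀ (E : Submodule ℂ (cmResidualSubspaceR L 3 μ).toSubmodule) (hE : ∀ k, ∀ x ∈ E, ((cmResidualSubspaceR L 3 μ).toContRep.restrict ιK) k x ∈ E),
      FiniteDimensional ℂ E → (((cmResidualSubspaceR L 3 μ).toContRep.restrict ιK).subRep E hE).IsIrreducible →
      ∃ T : Submodule ℂ ((cmDatum L 3 (Matrix.of fun i j : Fin 3 => if i.val + j.val + 1 = 3 then (1 : L) else 0)).Adelic → ℂ), FiniteDimensional ℂ T ∧
        ∀ w ∈ Representation.homRangeSum ((cmResidualSubspaceR L 3 μ).toContRep.restrict ιK).toRepresentation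
            (((cmResidualSubspaceR L 3 μ).toContRep.restrict ιK).subRep E hE),
          ∀ ψ : (cmDatum L 3 (Matrix.of fun i j : Fin 3 => if i.val + j.val + 1 = 3 then (1 : L) else 0)).automorphicQuotient → ℂ, Continuous ψ → ∀ hψ : MemLp ψ 2 μ,
            hψ.toLp ψ = ((w : (cmResidualSubspaceR L 3 μ).toSubmodule) : (cmDatum L 3 (Matrix.of fun i j : Fin 3 => if i.val + j.val + 1 = 3 then (1 : L) else 0)).L2 μ) →
              ∀ i, (fun x => ∫ u in 𝓕 i, ψ ((cmDatum L 3 (Matrix.of fun i j : Fin 3 => if i.val + j.val + 1 = 3 then (1 : L) else 0)).toAutomorphicQuotient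
                (x * (u : (cmDatum L 3 (Matrix.of fun i j : Fin 3 => if i.val + j.val + 1 = 3 then (1 : L) else 0)).Adelic)⁻¹)) ∂(νN i)) ∈ T) :
    CmResidualSpectrumCompactR L 3 μ :=
  residualSpectrumCompact_of_admissible _ μ (cmParabolicDataR L 3) ιK hι fun E hE hfd hirr => by
    haveI : ∀ i, Countable ((cmParabolicDataR L 3).rational i) := fun i => countable_rational_cmParabolicDataR_three L i
    haveI : ∀ i, LocallyCompactSpace ((cmParabolicDataR L 3).radical i) := fun i => (isClosed_cmParabolicDataR_radical_three L i).locallyCompactSpace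
    haveI : ∀ i, SecondCountableTopology ((cmParabolicDataR L 3).radical i) := fun i => TopologicalSpace.Subtype.secondCountableTopology _
    haveI : Finite (cmParabolicDataR L 3).ι := finite_index 3
    have hcpt : ∀ i : (cmParabolicDataR L 3).ι, ∃ C : Set ((cmParabolicDataR L 3).radical i), IsCompact C ∧
        ∀ u : (cmParabolicDataR L 3).radical i, ∃ l : (cmParabolicDataR L 3).rational i, l • u ∈ C := by
      intro i
      obtain ⟨k, hk⟩ := i
      obtain rfl : k = 1 := by omega
      exact exists_isCompact_rational_smul_mem_heisenberg L (antidiagOne_eq_over (L := L) (N := 3)).symm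
    choose C hC hcov using hcpt
    exact finiteDimensional_homRangeSum_of_exp _ μ (cmParabolicDataR L 3) C hC hcov νN 𝓕 h𝓕 ιK hι E hE (hexp E hE hfd hirr)

end Unitary

end Summit.HodgeConjecture.HodgeConjecture.Cruxes.H413.K2E1ResidualAdmissibleOfExponentsSmooth

end
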